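/-
Copyright (c) 2026 the pub-hodgecm-mathlib formalisation cell (harness21).  Prover seat hodgecm-mathlib-LH7-p05 (g2) on the CHAIR K2-lead VALVE,
Track B «K2-LIT» ∕ hLiu418 #184♮ = `stmt-HodgeConjecture-24832`, Road I v3, FACE-G road (E), brick (E-g-fin) 𝓢-side — the ARCH-LEG READING letter `hread` of
★ p863778 `K2LiuArchSWTruncationSectionsFinite` split into its ★-derivable parts and the ONE frame-unitarity letter `hKU` (by lineage, F4 DESK K2Liu-p27 (g2) 00:20:18Z;
box K2E5-r02 (g7) (S1) 00:43:18Z).  THEOREMS ONLY (no `def`, no `instance`, no notation, no named-fact hypothesis, no `sorry`); lane `--supports stmt-HodgeConjecture-24832 --as helper`.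
-/
import Summits.HodgeConjecture.HodgeConjecture.Theorems.K2LiuArchSWTruncationSectionsFinite  -- ★ p863778: `finiteDimensional_span_truncationSections`, `partner_letter_of_isStd`
import Summits.HodgeConjecture.HodgeConjecture.Theorems.K2LiuDoubledWeilRepFinHalf            -- ★ `omega_sD_tmul_eq` (`g = (g_∞,1)(1,g_f)` on pure tensors), `finRepMp`
import Summits.HodgeConjecture.HodgeConjecture.Theorems.K2LiuDoubledWeilRepArchPinned         -- ★ `omega_sD_archToAdelic_tmul` (the arch component, explicitly)
import Literature.NumberTheory.GelbartRogawski1991.DoubledWeilRepresentationArchVacuum         -- ★ `frameD`, `sectionD` (Folland frame ∕ section of the doubled space)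
import HarnessLib

/-!
# Crux `HLiu418`, FACE-G road (E), (E-g-fin) 𝓢-side: THE ARCH-LEG READING OF `ω(sB(k ⊗ 1))` ON PURE TENSORS — `hread` of ★ p863778 from the frame-unitarity letter alone

Cell `hodgecm-mathlib`, crux item hLiu418 = `stmt-HodgeConjecture-24832` (helper lane, count-neutral; closes no socket).  Namespace
`Summit.HodgeConjecture.HodgeConjecture.Cruxes.HLiu418.K2LiuArchSWTruncationReading`.

★ p863778 pays the `hfin` letter of the (E-g) HEAD ★ p863527 for a standard Iwasawa datum modulo ONE letter `hread`: for every `k ∈ 𝒦.K` the operator `ω(sB(k ⊗ 1))`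
(big doubled Weil representation along ★ `tensorEmb`) acts on pure tensors as `c • (x • ·) ⊗ B` with `x ∈ Mp^𝓢` lying over a UNITARY of the big Folland frame `frameD′`.
This file derives `hread` from the tree: (i) ★ `K2LiuDoubledWeilRepFinHalf.omega_sD_tmul_eq` splits `k ⊗ 1 = ((k ⊗ 1)_∞, 1)·(1, (k ⊗ 1)_f)` on pure tensors, the finite
factor acting by the finite representation `B := ω^B_f((k ⊗ 1)_f)` (★ `finRepMp`); (ii) ★ `K2LiuDoubledWeilRepArchPinned.omega_sD_archToAdelic_tmul` reads the archimedean
factor as `η_t((k ⊗ 1)_∞) • frameD′^* sectionD′((k ⊗ 1)_∞) frameD′_*` (for `χ_b` of odd unitary archimedean type `t` — ★ `IsSplittingChar.exists_hasUnitaryArchType_odd`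
supplies such `t`); so `x := sectionD′((k ⊗ 1)_∞)`, `c := η_t((k ⊗ 1)_∞)`, and the ONLY thing not in the tree is the FRAME-UNITARITY letter
`hKU : ∀ k ∈ 𝒦.K, ∃ u, MpS.proj (archWeilSectionS … ((k ⊗ 1)_∞)) = realifySp u` (★ `K2LiuDoubledWeilRepArchPinned`'s section term, = `sectionD′`) — «the compact of the Iwasawa datum of record acts through `U(σ′)` in the Fock frame `frameD′`»
(true for a frame-adapted compact, the (R1)∕sign-frame thread ★ `exists_conjDatum_frameCompact` ∕ `K2LiuIwasawaDatumOfRecordSignFrames`; FALSE for a conjugate maximal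
compact, for which `hfin` itself fails — so `hKU` is the honest residual).
* §1 **`hread_of_frameUnitary`** `(ht hodd) (hKU) : ‹hread bytes of ★ p863778›`.
* §2 **`finiteDimensional_span_truncationSections_of_frameUnitary`**, **`partner_letter_of_frameUnitary`** — ★ p863778's two heads with `hread` replaced by `(ht, hodd, hKU)`:
  the (partner) letter of ★ p863249 at `t := follandHermite frameD′` now stands modulo {`𝒦.IsStd`, `χ_b` odd unitary arch type, `hKU`}.
References: [Weil1964, Chap. III n° 37–38 pp. 188–190]; [BorelJacquet1979, §4.1]; [GelbartRogawski1991, §3.1 Prop. 3.1.1 p. 455]; [Paul1998, §1.2 (1.2.1)–(1.2.2) p. 389];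
[Folland1989, §4.2 Prop. (4.39)]; [KudlaRallis1994, §1 Thm. 1.1].
HONEST LABEL: HC_CM is proved only modulo the 7 printed citations (2 remaining named inputs: hLiu418 = stmt-HodgeConjecture-24832, h413 = stmt-HodgeConjecture-24833) until
rung 0 closes; count-neutral helper (`--supports stmt-HodgeConjecture-24832 --as helper`), closes no socket, moves no counter.
-/

set_option autoImplicit false
set_option linter.dupNamespace false -- the mandated namespace repeats `HodgeConjecture.HodgeConjecture`

noncomputable section

open scoped Matrix TensorProduct SchwartzMap Classical
open NumberField NumberField.mixedEmbedding IsDedekindDomain Filter Topology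
open Literature.NumberTheory.Automorphic Literature.NumberTheory.Automorphic.UnitaryGroup Literature.NumberTheory.GaloisRepresentations
open Literature.NumberTheory.GelbartRogawski1991 Literature.NumberTheory.GelbartRogawski1991.GRConstruction
open Literature.NumberTheory.GelbartRogawski1991.UnitaryDualPair
open Literature.NumberTheory.Automorphic.Liu2021.Def411WeilCarriersDoubling
open Literature.NumberTheory.Weil1964 Literature.Analysis.SegalBargmann Literature.RepresentationTheory.HeisenbergGroup
open Literature.NumberTheory.K2Lit.SiegelDoubled
open Summit.HodgeConjecture.HodgeConjecture.Cruxes.HLiu418.K2LiuFaceGLetterDefs (genFamily IsArchStable)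
open Summit.HodgeConjecture.HodgeConjecture.Cruxes.HLiu418.K2LiuDoubledWeilRepFinHalf (omega_sD_tmul_eq)
open Summit.HodgeConjecture.HodgeConjecture.Cruxes.HLiu418.K2LiuDoubledWeilRepArchPinned (omega_sD_archToAdelic_tmul)
open Summit.HodgeConjecture.HodgeConjecture.Cruxes.HLiu418.K2LiuArchSWTruncationSectionsFinite
  (finiteDimensional_span_truncationSections partner_letter_of_isStd)

namespace Summit.HodgeConjecture.HodgeConjecture.Cruxes.HLiu418.K2LiuArchSWTruncationReading

variable (L : Type) [Field L] [NumberField L] [IsCMField L] {n : ℕ} (e : Fin 2 × Fin 1 ≃ Fin n)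
  (dV : Fin 2 → L) (hdV : ∀ i, IsCMField.complexConj L (dV i) = dV i) (hdV0 : ∀ i, dV i ≠ 0)
  (dW : Fin 1 → L) (hdW : ∀ i, IsCMField.complexConj L (dW i) = dW i) (hdW0 : ∀ i, dW i ≠ 0)
  {M' n' : ℕ} (eW : Fin 1 × Fin 3 ≃ Fin M') (e' : Fin 2 × Fin M' ≃ Fin n')
  (dV' : Fin 3 → L) (hdV' : ∀ k, IsCMField.complexConj L (dV' k) = dV' k) (hdV'0 : ∀ k, dV' k ≠ 0)
  (χb : HeckeCharacter L) (hχbu : χb.IsUnitary) (hχbs : Literature.RepresentationTheory.HarrisKudlaSweet1996.IsSplittingChar L 1 χb)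
  (α : UnitaryGroup.adelicOne (Fp L) L (IsCMField.complexConj L) →* ℂˣ) (𝒦 : IwasawaDatum L e dV hdV dW hdW)

/-! ## §1 `hread` from the frame-unitarity letter -/

set_option maxHeartbeats 2000000 in -- the big datum's carrier telescope `archPart (tensorEmb k)` (as ★ U2f `K2LiuTensorEmbArchFinParts`)
/-- **THE ARCH-LEG READING OF `ω(sB(k ⊗ 1))` ON PURE TENSORS** (= the `hread` letter of ★ p863778, bytes verbatim): for `χ_b` of odd unitary archimedean type `t` and
every `k ∈ 𝒦.K`, `ω(sB(k ⊗ 1)) E(a ⊗ φ) = η_t((k ⊗ 1)_∞) • E((frameD′^* sectionD′((k ⊗ 1)_∞) frameD′_*) a ⊗ ω^B_f((k ⊗ 1)_f) φ)` (★ `omega_sD_tmul_eq` ∘ ★ `omega_sD_archToAdelic_tmul` at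
the big datum), with `sectionD′((k ⊗ 1)_∞)` over a unitary by the letter `hKU`. [cite: Weil1964, Chap. III n° 37–38 pp. 188–190] [cite: BorelJacquet1979, §4.1]
[cite: GelbartRogawski1991, §3.1 Prop. 3.1.1 p. 455] [cite: Paul1998, §1.2 (1.2.1)–(1.2.2) p. 389] -/
theorem hread_of_frameUnitary {t : InfinitePlace L → ℤ} (ht : χb.HasUnitaryArchType t 0) (hodd : ∀ w, Odd (t w))
    (hKU : ∀ k ∈ 𝒦.K, ∃ u : Matrix.unitaryGroup (Fin (n' + n') × {v : InfinitePlace (Fp L) // v.IsReal}) ℂ,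
      MpS.proj (archWeilSectionS L (IsCMField.complexConj L) (n' + n') (IsCMField.complexConj_ne_one L) (cmPlaceOver L) (cmPlaceOver_smul L)
        (cmPlaceOver_comap L) _ (gramD_gram_realDiagonal_entry_ne_zero L e' dV hdV (tensorFrame L dW eW dV') (tensorFrame_real L dW hdW eW dV' hdV') hdV0
          (tensorFrame_ne_zero L dW eW dV' hdW0 hdV'0))
        (gramD_eq_diagonal_cm L e' dV hdV (tensorFrame L dW eW dV') (tensorFrame_real L dW hdW eW dV' hdV'))
        (J := hermD L e' dV hdV (tensorFrame L dW eW dV') (tensorFrame_real L dW hdW eW dV' hdV')) rfl (complexConj_imagUnit L) (imagUnit_ne_zero L)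
        (UnitaryGroup.archPart (Fp L) L (IsCMField.complexConj L) (n' + n')
          (hermD L e' dV hdV (tensorFrame L dW eW dV') (tensorFrame_real L dW hdW eW dV' hdV')) (tensorEmb L e dV hdV dW hdW eW e' dV' hdV' k))) =
        realifySp (Fin (n' + n') × {v : InfinitePlace (Fp L) // v.IsReal}) u) :
    ∀ k ∈ 𝒦.K, ∃ (x : MpS (Fin (n' + n') × {v : InfinitePlace (Fp L) // v.IsReal}))
      (u : Matrix.unitaryGroup (Fin (n' + n') × {v : InfinitePlace (Fp L) // v.IsReal}) ℂ) (c : ℂ)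
      (B : FinSB (Fp L) (Fin (n' + n')) →ₗ[ℂ] FinSB (Fp L) (Fin (n' + n'))),
      MpS.proj x = realifySp (Fin (n' + n') × {v : InfinitePlace (Fp L) // v.IsReal}) u ∧
      ∀ (a : 𝓢(((Fin (n' + n')) → mixedSpace (Fp L)), ℂ)) (φ : FinSB (Fp L) (Fin (n' + n'))),
        adelicMpCont.omega (Fp L) (Fin (n' + n')) (gramDA L e' dV hdV (tensorFrame L dW eW dV') (tensorFrame_real L dW hdW eW dV' hdV'))
            ((doubledWeilRep L e' dV hdV hdV0 (tensorFrame L dW eW dV') (tensorFrame_real L dW hdW eW dV' hdV')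
                  (tensorFrame_ne_zero L dW eW dV' hdW0 hdV'0) χb hχbu hχbs) (tensorEmb L e dV hdV dW hdW eW e' dV' hdV' k))
            (piSchwartzBruhatEquiv (Fp L) (Fin (n' + n')) (a ⊗ₜ[ℂ] φ)) =
          c • piSchwartzBruhatEquiv (Fp L) (Fin (n' + n'))
            (carrierConjEquiv (frameD L e' dV hdV hdV0 (tensorFrame L dW eW dV') (tensorFrame_real L dW hdW eW dV' hdV')
                (tensorFrame_ne_zero L dW eW dV' hdW0 hdV'0)) x.1.2 a ⊗ₜ[ℂ] B φ) := by
  have hsB := isDoubledWeilRep_doubledWeilRep L e' dV hdV hdV0 (tensorFrame L dW eW dV') (tensorFrame_real L dW hdW eW dV' hdV')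
    (tensorFrame_ne_zero L dW eW dV' hdW0 hdV'0) χb hχbu hχbs
  intro k hk
  obtain ⟨u, hu⟩ := hKU k hk
  refine ⟨_, u, ?_, ?_, hu, fun a φ => ?_⟩
  rotate_left 2
  refine (omega_sD_tmul_eq L e' dV hdV hdV0 (tensorFrame L dW eW dV') (tensorFrame_real L dW hdW eW dV' hdV')
      (tensorFrame_ne_zero L dW eW dV' hdW0 hdV'0) hsB (tensorEmb L e dV hdV dW hdW eW e' dV' hdV' k) a φ).trans ?_
  exact omega_sD_archToAdelic_tmul L e' dV hdV hdV0 (tensorFrame L dW eW dV') (tensorFrame_real L dW hdW eW dV' hdV')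
      (tensorFrame_ne_zero L dW eW dV' hdW0 hdV'0) hχbu hχbs hsB ht hodd _ a _

/-! ## §2 ★ p863778's heads with `hread` replaced by the frame-unitarity letter -/

set_option maxHeartbeats 2000000 in -- the big datum's carrier telescope `archPart (tensorEmb k)` (as ★ U2f `K2LiuTensorEmbArchFinParts`)
/-- **`hfin` OF ★ p863527 FROM {`𝒦.IsStd`, `χ_b` ODD UNITARY ARCH TYPE, `hKU`}** (★ p863778 `finiteDimensional_span_truncationSections` ∘ §1).
[cite: KudlaRallis1994, §1 Thm. 1.1] [cite: Folland1989, §4.2 Prop. (4.39)] -/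
theorem finiteDimensional_span_truncationSections_of_frameUnitary (h𝒦 : 𝒦.IsStd)
    {t : InfinitePlace L → ℤ} (ht : χb.HasUnitaryArchType t 0) (hodd : ∀ w, Odd (t w))
    (hKU : ∀ k ∈ 𝒦.K, ∃ u : Matrix.unitaryGroup (Fin (n' + n') × {v : InfinitePlace (Fp L) // v.IsReal}) ℂ,
      MpS.proj (archWeilSectionS L (IsCMField.complexConj L) (n' + n') (IsCMField.complexConj_ne_one L) (cmPlaceOver L) (cmPlaceOver_smul L)
        (cmPlaceOver_comap L) _ (gramD_gram_realDiagonal_entry_ne_zero L e' dV hdV (tensorFrame L dW eW dV') (tensorFrame_real L dW hdW eW dV' hdV') hdV0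
          (tensorFrame_ne_zero L dW eW dV' hdW0 hdV'0))
        (gramD_eq_diagonal_cm L e' dV hdV (tensorFrame L dW eW dV') (tensorFrame_real L dW hdW eW dV' hdV'))
        (J := hermD L e' dV hdV (tensorFrame L dW eW dV') (tensorFrame_real L dW hdW eW dV' hdV')) rfl (complexConj_imagUnit L) (imagUnit_ne_zero L)
        (UnitaryGroup.archPart (Fp L) L (IsCMField.complexConj L) (n' + n')
          (hermD L e' dV hdV (tensorFrame L dW eW dV') (tensorFrame_real L dW hdW eW dV' hdV')) (tensorEmb L e dV hdV dW hdW eW e' dV' hdV' k))) =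
        realifySp (Fin (n' + n') × {v : InfinitePlace (Fp L) // v.IsReal}) u)
    (V : Submodule ℂ 𝓢(((Fin (n' + n')) → mixedSpace (Fp L)), ℂ)) [FiniteDimensional ℂ V]
    (hVst : IsArchStable L e dV hdV hdV0 dW hdW hdW0 eW e' dV' hdV' hdV'0 χb hχbu hχbs 𝒦 V) (f : FinSB (Fp L) (Fin (n' + n'))) :
    FiniteDimensional ℂ ↥(Submodule.span ℂ {φ : HA L e dV hdV dW hdW → ℂ | ∃ (N : ℕ) (v : 𝓢(((Fin (n' + n')) → mixedSpace (Fp L)), ℂ)), v ∈ V ∧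
      φ = fun h => swSectionTensor L e dV hdV dW hdW eW e' dV' hdV' hdV0 hdW0 hdV'0
        (doubledWeilRep L e' dV hdV hdV0 (tensorFrame L dW eW dV') (tensorFrame_real L dW hdW eW dV' hdV')
          (tensorFrame_ne_zero L dW eW dV' hdW0 hdV'0) χb hχbu hχbs)
        (piSchwartzBruhatEquiv (Fp L) (Fin (n' + n'))
          ((schwartzTransport (frameD L e' dV hdV hdV0 (tensorFrame L dW eW dV') (tensorFrame_real L dW hdW eW dV' hdV')
              (tensorFrame_ne_zero L dW eW dV' hdW0 hdV'0))).symm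
            (schwartzTransport (euclE (Fin (n' + n') × {v : InfinitePlace (Fp L) // v.IsReal}))
              (∑ d ∈ Finset.range N, degProjS d
                ((schwartzTransport (euclE (Fin (n' + n') × {v : InfinitePlace (Fp L) // v.IsReal}))).symm
                  (schwartzTransport (frameD L e' dV hdV hdV0 (tensorFrame L dW eW dV') (tensorFrame_real L dW hdW eW dV' hdV')
                    (tensorFrame_ne_zero L dW eW dV' hdW0 hdV'0)) v)))) ⊗ₜ[ℂ] f)) h}) :=
  finiteDimensional_span_truncationSections L e dV hdV hdV0 dW hdW hdW0 eW e' dV' hdV' hdV'0 χb hχbu hχbs 𝒦 h𝒦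
    (hread_of_frameUnitary L e dV hdV hdV0 dW hdW hdW0 eW e' dV' hdV' hdV'0 χb hχbu hχbs 𝒦 ht hodd hKU) V hVst f

set_option maxHeartbeats 2000000 in -- the big datum's carrier telescope `archPart (tensorEmb k)` (as ★ U2f `K2LiuTensorEmbArchFinParts`)
/-- **THE (partner) LETTER OF ★ `K2LiuArchSWDataFinalPassage.forall_domain_good_of_archGenerators` AT `t := follandHermite frameD′` FROM {`𝒦.IsStd`, `χ_b` ODD UNITARY ARCH
TYPE, `hKU`}** (★ p863778 `partner_letter_of_isStd` ∘ §1). [cite: KudlaRallis1994, §1 Thm. 1.1] [cite: Howe1989, §3] [cite: Folland1989, §1.7 (1.81)] -/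
theorem partner_letter_of_frameUnitary (h𝒦 : 𝒦.IsStd)
    {t : InfinitePlace L → ℤ} (ht : χb.HasUnitaryArchType t 0) (hodd : ∀ w, Odd (t w))
    (hKU : ∀ k ∈ 𝒦.K, ∃ u : Matrix.unitaryGroup (Fin (n' + n') × {v : InfinitePlace (Fp L) // v.IsReal}) ℂ,
      MpS.proj (archWeilSectionS L (IsCMField.complexConj L) (n' + n') (IsCMField.complexConj_ne_one L) (cmPlaceOver L) (cmPlaceOver_smul L)
        (cmPlaceOver_comap L) _ (gramD_gram_realDiagonal_entry_ne_zero L e' dV hdV (tensorFrame L dW eW dV') (tensorFrame_real L dW hdW eW dV' hdV') hdV0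
          (tensorFrame_ne_zero L dW eW dV' hdW0 hdV'0))
        (gramD_eq_diagonal_cm L e' dV hdV (tensorFrame L dW eW dV') (tensorFrame_real L dW hdW eW dV' hdV'))
        (J := hermD L e' dV hdV (tensorFrame L dW eW dV') (tensorFrame_real L dW hdW eW dV' hdV')) rfl (complexConj_imagUnit L) (imagUnit_ne_zero L)
        (UnitaryGroup.archPart (Fp L) L (IsCMField.complexConj L) (n' + n')
          (hermD L e' dV hdV (tensorFrame L dW eW dV') (tensorFrame_real L dW hdW eW dV' hdV')) (tensorEmb L e dV hdV dW hdW eW e' dV' hdV' k))) =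
        realifySp (Fin (n' + n') × {v : InfinitePlace (Fp L) // v.IsReal}) u) :
    ∀ (V : Submodule ℂ 𝓢(((Fin (n' + n')) → mixedSpace (Fp L)), ℂ)), FiniteDimensional ℂ V →
      IsArchStable L e dV hdV hdV0 dW hdW hdW0 eW e' dV' hdV' hdV'0 χb hχbu hχbs 𝒦 V →
      ∀ a ∈ V, ∀ f : FinSB (Fp L) (Fin (n' + n')), ∃ w ∈ Submodule.span ℂ (Set.range (follandHermite
        (frameD L e' dV hdV hdV0 (tensorFrame L dW eW dV') (tensorFrame_real L dW hdW eW dV' hdV') (tensorFrame_ne_zero L dW eW dV' hdW0 hdV'0)))),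
        genFamily L e dV hdV hdV0 dW hdW hdW0 eW e' dV' hdV' hdV'0 χb hχbu hχbs α 𝒦 (piSchwartzBruhatEquiv (Fp L) (Fin (n' + n')) (w ⊗ₜ[ℂ] f)) =
          genFamily L e dV hdV hdV0 dW hdW hdW0 eW e' dV' hdV' hdV'0 χb hχbu hχbs α 𝒦 (piSchwartzBruhatEquiv (Fp L) (Fin (n' + n')) (a ⊗ₜ[ℂ] f)) :=
  partner_letter_of_isStd L e dV hdV hdV0 dW hdW hdW0 eW e' dV' hdV' hdV'0 χb hχbu hχbs α 𝒦 h𝒦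
    (hread_of_frameUnitary L e dV hdV hdV0 dW hdW hdW0 eW e' dV' hdV' hdV'0 χb hχbu hχbs 𝒦 ht hodd hKU)

end Summit.HodgeConjecture.HodgeConjecture.Cruxes.HLiu418.K2LiuArchSWTruncationReading

end
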